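import Summits.Ventures.Crystal3D.Theorems.StickyWulffConstantCoaxialWallLawLatticeContactsBridge
import Summits.Ventures.Crystal3D.Theorems.StickyWulffConstantCoaxialWallLawFrame
import HarnessLib

/-!
# FOUR LATTICE CONTACTS FORCE A LATTICE POINT (crux `CoaxialWallLaw`, stmt-Ventures-19481, line `WallLedgerF`; rigidity lemma of the line of
# `stub_multiGrainSmallHigh`)

HONEST FRAMING. Venture `Summits/Ventures/Crystal3D` (cell `crystal3d-full`), helper `--supports` the crux `CoaxialWallLaw` of
`route-Ventures-StickyWulffConstant` (REGISTERED line `WallLedgerF`, skeleton 'CoaxialWallLawCertificates' v4, stub `stub_multiGrainSmallHigh :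
KissingGap (5/2) → KissingClassification (5/2) → TailResidue.MultiGrainSmallHigh (2√6) 3`).  Rung credit only; F-C1 not moved; census-free.
cf-p1 (clxxxii): «the locking lemma and the tetravacancy rigidity fact land as LEMMAS of T5b's line» — this is the global rigidity fact (C1) of memo
HOME/wall-19481-p2/F-TAIL-g10.md §10, on top of `…LatticeContactsTable` (kernel table) and `…LatticeContactsBridge` (real algebra):
* `exists_slot_of_check` (dispatch on the kernel's branches), `dotZ_flip` / `dotR_flip` / `flip_flip` (sign normal form),
  **`exists_slot_core`** — `|u|² = 2` and three distinct nonzero `D₃`-vectors `a, b, c` with `2u·a = |a|²`, `2u·b = |b|²`, `2u·c = |c|²` force `u ∈ S12`;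
* **`mem_fcc_of_three_site_contacts`** — a point at distance `1` from `0` and from three distinct nonzero sites of `Λ₀` is a site of `Λ₀`
  (cubic coordinates: `exists_even_cubic_of_mem_fcc`, `mem_fcc_of_even_cubic`);
* **`mem_lattice_of_four_contacts`** — for a frame `G` and a host `y`: four distinct points of the coset `y + G·Λ₀` at distance `1` from `x` force
  `x ∈ y + G·Λ₀`; **`card_lattice_contacts_le_three`** — an off-lattice `x` touches at most three balls of `X` on `y + G·Λ₀` (the global form of
  `…ForeignContacts.foreign_contact_frame_contacts_le_two`: dust jammed against a crystallite touches `≤ 3` of its balls).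
WHAT THIS IS NOT: not the stub (the jammed-dust census it serves is booked with cf-p2/eng); F-C1 not moved.
-/

noncomputable section

namespace Summit.Ventures.Crystal3D.Theorems

namespace LatticeContacts

open Summit.Ventures.Crystal3D Finset
open Literature.MathematicalPhysics.StatisticalMechanics (fccStacking)
open scoped InnerProductSpace

/-! ### §4 From the kernel table to the slot -/

section Core

variable {u0 u1 u2 : ℝ}

/-- **Dispatch**: a passing kernel check and the real equations put `u` on a slot. -/
theorem exists_slot_of_check {a b c : V3} (h : check a b c = true) (hu : u0 ^ 2 + u1 ^ 2 + u2 ^ 2 = 2)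
    (ha : 2 * dotR u0 u1 u2 a = (dotZ a a : ℝ)) (hb : 2 * dotR u0 u1 u2 b = (dotZ b b : ℝ))
    (hc : 2 * dotR u0 u1 u2 c = (dotZ c c : ℝ)) (hab : a ≠ b) (hac : a ≠ c) (hbc : b ≠ c) :
    ∃ σ ∈ S12, u0 = (σ.1 : ℝ) ∧ u1 = (σ.2.1 : ℝ) ∧ u2 = (σ.2.2 : ℝ) := by
  have h1 : ¬ (8 < dotZ (subZ a b) (subZ a b) ∨ 8 < dotZ (subZ a c) (subZ a c) ∨ 8 < dotZ (subZ b c) (subZ b c)) := by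
    push Not
    exact ⟨dotZ_sub_le_eight hu ha hb, dotZ_sub_le_eight hu ha hc, dotZ_sub_le_eight hu hb hc⟩
  have h2 : ¬ (a = b ∨ a = c ∨ b = c) := by
    push Not; exact ⟨hab, hac, hbc⟩
  unfold check at h
  rw [if_neg h1, if_neg h2] at h
  split_ifs at h with hd hn1 hn2
  · exact exists_slot_of_fullCheck hd h hu ha hb hc
  · exact exists_slot_of_rank2Check hn1 h hu ha hb hc
  · exact exists_slot_of_rank2Check hn2 h hu ha hc hb

/-- Sign flips preserve integer pairings. -/
theorem dotZ_flip {e : V3} (he : e ∈ signs8) (p q : V3) : dotZ (flipZ e p) (flipZ e q) = dotZ p q := by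
  obtain ⟨h1, h2, h3⟩ := signs8_sq e he
  simp only [dotZ, flipZ]
  linear_combination (p.1 * q.1) * h1 + (p.2.1 * q.2.1) * h2 + (p.2.2 * q.2.2) * h3

/-- Sign flips preserve real pairings. -/
theorem dotR_flip {e : V3} (he : e ∈ signs8) (p : V3) :
    dotR (e.1 * u0) (e.2.1 * u1) (e.2.2 * u2) (flipZ e p) = dotR u0 u1 u2 p := by
  obtain ⟨h1, h2, h3⟩ := signs8_sq e he
  have h1' : ((e.1 : ℝ)) * e.1 = 1 := by exact_mod_cast h1
  have h2' : ((e.2.1 : ℝ)) * e.2.1 = 1 := by exact_mod_cast h2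
  have h3' : ((e.2.2 : ℝ)) * e.2.2 = 1 := by exact_mod_cast h3
  simp only [dotR, flipZ]; push_cast
  linear_combination (u0 * p.1) * h1' + (u1 * p.2.1) * h2' + (u2 * p.2.2) * h3'

/-- Sign flips are involutions. -/
theorem flip_flip {e : V3} (he : e ∈ signs8) (p : V3) : flipZ e (flipZ e p) = p := by
  obtain ⟨h1, h2, h3⟩ := signs8_sq e he
  obtain ⟨x, y, z⟩ := p
  simp only [flipZ, Prod.mk.injEq]
  exact ⟨by rw [← mul_assoc, h1, one_mul], by rw [← mul_assoc, h2, one_mul], by rw [← mul_assoc, h3, one_mul]⟩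

/-- **THE CORE THEOREM (integer cubic coordinates).**  If `u ∈ ℝ³` has `|u|² = 2` and three distinct nonzero `D₃`-vectors
`a, b, c` satisfy `2 u·a = |a|²`, `2 u·b = |b|²`, `2 u·c = |c|²` (i.e. `0, a, b, c` are at distance `√2` from `u`), then `u` is one of the
twelve slots. -/
theorem exists_slot_core (hu : u0 ^ 2 + u1 ^ 2 + u2 ^ 2 = 2) {a b c : V3}
    (hae : (a.1 + a.2.1 + a.2.2) % 2 = 0) (hbe : (b.1 + b.2.1 + b.2.2) % 2 = 0) (hce : (c.1 + c.2.1 + c.2.2) % 2 = 0)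
    (ha0 : a ≠ (0, 0, 0)) (hb0 : b ≠ (0, 0, 0)) (hc0 : c ≠ (0, 0, 0)) (hab : a ≠ b) (hac : a ≠ c) (hbc : b ≠ c)
    (ha : 2 * dotR u0 u1 u2 a = (dotZ a a : ℝ)) (hb : 2 * dotR u0 u1 u2 b = (dotZ b b : ℝ))
    (hc : 2 * dotR u0 u1 u2 c = (dotZ c c : ℝ)) :
    ∃ σ ∈ S12, u0 = (σ.1 : ℝ) ∧ u1 = (σ.2.1 : ℝ) ∧ u2 = (σ.2.2 : ℝ) := by
  have haT := mem_T54 a hae ha0 (dotZ_self_le_eight hu ha)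
  have hbT := mem_T54 b hbe hb0 (dotZ_self_le_eight hu hb)
  have hcT := mem_T54 c hce hc0 (dotZ_self_le_eight hu hc)
  obtain ⟨e, he, hea⟩ := exists_flip_mem_reps12 a haT
  obtain ⟨h1, h2, h3⟩ := signs8_sq e he
  have h1' : ((e.1 : ℝ)) * e.1 = 1 := by exact_mod_cast h1
  have h2' : ((e.2.1 : ℝ)) * e.2.1 = 1 := by exact_mod_cast h2
  have h3' : ((e.2.2 : ℝ)) * e.2.2 = 1 := by exact_mod_cast h3
  -- the flipped data
  have hu' : ((e.1 : ℝ) * u0) ^ 2 + ((e.2.1 : ℝ) * u1) ^ 2 + ((e.2.2 : ℝ) * u2) ^ 2 = 2 := by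
    linear_combination hu + (u0 ^ 2) * h1' + (u1 ^ 2) * h2' + (u2 ^ 2) * h3'
  have hinj : ∀ p q : V3, flipZ e p = flipZ e q → p = q := fun p q hpq => by
    rw [← flip_flip he p, ← flip_flip he q, hpq]
  have key := table (flipZ e a) hea (flipZ e b) (flip_mem_T54 e he b hbT) (flipZ e c) (flip_mem_T54 e he c hcT)
  obtain ⟨σ, hσ, e0, e1, e2⟩ := exists_slot_of_check key hu'
    (by rw [dotR_flip he, dotZ_flip he]; exact ha) (by rw [dotR_flip he, dotZ_flip he]; exact hb)
    (by rw [dotR_flip he, dotZ_flip he]; exact hc)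
    (fun h => hab (hinj _ _ h)) (fun h => hac (hinj _ _ h)) (fun h => hbc (hinj _ _ h))
  refine ⟨flipZ e σ, flip_mem_S12 e he σ hσ, ?_, ?_, ?_⟩
  · simp only [flipZ]; push_cast; rw [← e0]; linear_combination (-u0) * h1'
  · simp only [flipZ]; push_cast; rw [← e1]; linear_combination (-u1) * h2'
  · simp only [flipZ]; push_cast; rw [← e2]; linear_combination (-u2) * h3'

/-- Slots are `D₃`-vectors. -/
theorem S12_even : ∀ σ ∈ S12, Even (σ.1 + σ.2.1 + σ.2.2) := by
  decide

end Core

/-! ### §5 Geometry: four lattice contacts force a lattice point -/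

section Geometry

/-- `Σ (√2 cᵢ)² = 2‖x‖²`. -/
theorem cubic_sum_sq (x : EuclideanSpace ℝ (Fin 3)) :
    (Real.sqrt 2 * cubicCoords x 0) ^ 2 + (Real.sqrt 2 * cubicCoords x 1) ^ 2 + (Real.sqrt 2 * cubicCoords x 2) ^ 2 =
      2 * ‖x‖ ^ 2 := by
  have h := norm_sq_eq_cubicCoords x
  have h2 : Real.sqrt 2 ^ 2 = 2 := Real.sq_sqrt (by norm_num)
  simp only [dotProduct, Fin.sum_univ_three] at h
  rw [h]; ring_nf; rw [h2]; ring

/-- **A point at distance `1` from `0` and from three distinct nonzero sites of `Λ₀` is a site of `Λ₀`** (model coordinates). -/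
theorem mem_fcc_of_three_site_contacts {x v₁ v₂ v₃ : EuclideanSpace ℝ (Fin 3)} (hx : ‖x‖ = 1)
    (h₁ : v₁ ∈ fccStacking 1 (Real.sqrt (2 / 3))) (h₂ : v₂ ∈ fccStacking 1 (Real.sqrt (2 / 3)))
    (h₃ : v₃ ∈ fccStacking 1 (Real.sqrt (2 / 3))) (h₁0 : v₁ ≠ 0) (h₂0 : v₂ ≠ 0) (h₃0 : v₃ ≠ 0)
    (h₁₂ : v₁ ≠ v₂) (h₁₃ : v₁ ≠ v₃) (h₂₃ : v₂ ≠ v₃)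
    (hd₁ : dist x v₁ = 1) (hd₂ : dist x v₂ = 1) (hd₃ : dist x v₃ = 1) :
    x ∈ fccStacking 1 (Real.sqrt (2 / 3)) := by
  -- integer cubic coordinates of the sites
  obtain ⟨a0, a1, a2, hae, ha0, ha1, ha2⟩ := exists_even_cubic_of_mem_fcc h₁
  obtain ⟨b0, b1, b2, hbe, hb0, hb1, hb2⟩ := exists_even_cubic_of_mem_fcc h₂
  obtain ⟨c0, c1, c2, hce, hc0, hc1, hc2⟩ := exists_even_cubic_of_mem_fcc h₃
  set u0 := Real.sqrt 2 * cubicCoords x 0 with hu0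
  set u1 := Real.sqrt 2 * cubicCoords x 1 with hu1
  set u2 := Real.sqrt 2 * cubicCoords x 2 with hu2
  have hu : u0 ^ 2 + u1 ^ 2 + u2 ^ 2 = 2 := by rw [hu0, hu1, hu2, cubic_sum_sq, hx]; norm_num
  -- the contact equations `2 u·a = |a|²`
  have contact : ∀ {v : EuclideanSpace ℝ (Fin 3)} {z0 z1 z2 : ℤ}, Real.sqrt 2 * cubicCoords v 0 = z0 →
      Real.sqrt 2 * cubicCoords v 1 = z1 → Real.sqrt 2 * cubicCoords v 2 = z2 → dist x v = 1 →
      2 * dotR u0 u1 u2 (z0, z1, z2) = (dotZ (z0, z1, z2) (z0, z1, z2) : ℝ) := by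
    intro v z0 z1 z2 e0 e1 e2 hd
    have hsq := cubic_sum_sq (x - v)
    rw [← dist_eq_norm, hd, cubicCoords_sub] at hsq
    simp only [Pi.sub_apply, mul_sub] at hsq
    rw [e0, e1, e2, ← hu0, ← hu1, ← hu2] at hsq
    simp only [dotR, dotZ]; push_cast
    linear_combination hu - hsq
  have hA := contact ha0 ha1 ha2 hd₁
  have hB := contact hb0 hb1 hb2 hd₂
  have hC := contact hc0 hc1 hc2 hd₃
  -- distinctness and non-vanishing of the integer vectors
  have cubic_inj : ∀ {v w : EuclideanSpace ℝ (Fin 3)} {z0 z1 z2 : ℤ}, Real.sqrt 2 * cubicCoords v 0 = z0 →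
      Real.sqrt 2 * cubicCoords v 1 = z1 → Real.sqrt 2 * cubicCoords v 2 = z2 → Real.sqrt 2 * cubicCoords w 0 = z0 →
      Real.sqrt 2 * cubicCoords w 1 = z1 → Real.sqrt 2 * cubicCoords w 2 = z2 → v = w := by
    intro v w z0 z1 z2 e0 e1 e2 f0 f1 f2
    have hs : Real.sqrt 2 ≠ 0 := by positivity
    apply cubicCoords_injective
    ext i; fin_cases i
    · exact mul_left_cancel₀ hs (by simp only [Fin.zero_eta]; rw [e0, f0])
    · exact mul_left_cancel₀ hs (by simp only [Fin.mk_one]; rw [e1, f1])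
    · exact mul_left_cancel₀ hs (by simp only [Fin.reduceFinMk]; rw [e2, f2])
  have hz0 : Real.sqrt 2 * cubicCoords (0 : EuclideanSpace ℝ (Fin 3)) 0 = ((0 : ℤ) : ℝ) ∧
      Real.sqrt 2 * cubicCoords (0 : EuclideanSpace ℝ (Fin 3)) 1 = ((0 : ℤ) : ℝ) ∧
      Real.sqrt 2 * cubicCoords (0 : EuclideanSpace ℝ (Fin 3)) 2 = ((0 : ℤ) : ℝ) := by
    have : cubicCoords (0 : EuclideanSpace ℝ (Fin 3)) = 0 := by
      have h := cubicCoords_smul 0 (0 : EuclideanSpace ℝ (Fin 3))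
      rw [zero_smul, zero_smul] at h; exact h
    simp [this]
  have neq : ∀ {v w : EuclideanSpace ℝ (Fin 3)} {y0 y1 y2 z0 z1 z2 : ℤ}, v ≠ w → Real.sqrt 2 * cubicCoords v 0 = y0 →
      Real.sqrt 2 * cubicCoords v 1 = y1 → Real.sqrt 2 * cubicCoords v 2 = y2 → Real.sqrt 2 * cubicCoords w 0 = z0 →
      Real.sqrt 2 * cubicCoords w 1 = z1 → Real.sqrt 2 * cubicCoords w 2 = z2 → ((y0, y1, y2) : V3) ≠ (z0, z1, z2) := by
    intro v w y0 y1 y2 z0 z1 z2 hvw e0 e1 e2 f0 f1 f2 heq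
    simp only [Prod.mk.injEq] at heq
    obtain ⟨rfl, rfl, rfl⟩ := heq
    exact hvw (cubic_inj e0 e1 e2 f0 f1 f2)
  have hpa : (a0 + a1 + a2) % 2 = 0 := Int.even_iff.1 hae
  have hpb : (b0 + b1 + b2) % 2 = 0 := Int.even_iff.1 hbe
  have hpc : (c0 + c1 + c2) % 2 = 0 := Int.even_iff.1 hce
  obtain ⟨σ, hσ, e0, e1, e2⟩ := exists_slot_core hu hpa hpb hpc
    (neq h₁0 ha0 ha1 ha2 hz0.1 hz0.2.1 hz0.2.2) (neq h₂0 hb0 hb1 hb2 hz0.1 hz0.2.1 hz0.2.2)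
    (neq h₃0 hc0 hc1 hc2 hz0.1 hz0.2.1 hz0.2.2) (neq h₁₂ ha0 ha1 ha2 hb0 hb1 hb2) (neq h₁₃ ha0 ha1 ha2 hc0 hc1 hc2)
    (neq h₂₃ hb0 hb1 hb2 hc0 hc1 hc2) hA hB hC
  exact mem_fcc_of_even_cubic σ.1 σ.2.1 σ.2.2 (S12_even σ hσ) (by rw [← e0]) (by rw [← e1]) (by rw [← e2])

/-- **FOUR LATTICE CONTACTS FORCE A LATTICE POINT.**  For a frame `G` and a host `y`: if four distinct points of the lattice coset
`y + G·Λ₀` are at distance `1` from `x`, then `x ∈ y + G·Λ₀`. -/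
theorem mem_lattice_of_four_contacts (G : EuclideanSpace ℝ (Fin 3) ≃ₗᵢ[ℝ] EuclideanSpace ℝ (Fin 3))
    (y x : EuclideanSpace ℝ (Fin 3)) (p : Fin 4 → EuclideanSpace ℝ (Fin 3)) (hp : Function.Injective p)
    (hlat : ∀ i, G.symm (p i - y) ∈ fccStacking 1 (Real.sqrt (2 / 3))) (hd : ∀ i, dist x (p i) = 1) :
    G.symm (x - y) ∈ fccStacking 1 (Real.sqrt (2 / 3)) := by
  -- model coordinates about `p 0`
  set x' := G.symm (x - p 0) with hx'
  have hv : ∀ i, G.symm (p i - p 0) ∈ fccStacking 1 (Real.sqrt (2 / 3)) := fun i => by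
    have h := fcc_sub_site_mem (hlat i) (hlat 0)
    rwa [← map_sub, sub_sub_sub_cancel_right] at h
  have hdist : ∀ i, dist x' (G.symm (p i - p 0)) = 1 := fun i => by
    rw [hx', dist_eq_norm, ← map_sub, LinearIsometryEquiv.norm_map, sub_sub_sub_cancel_right, ← dist_eq_norm]; exact hd i
  have hnorm : ‖x'‖ = 1 := by
    rw [hx', LinearIsometryEquiv.norm_map, ← dist_eq_norm]; exact hd 0
  have hne : ∀ i j, i ≠ j → G.symm (p i - p 0) ≠ G.symm (p j - p 0) := fun i j hij h =>
    hij (hp (sub_left_injective (G.symm.injective h)))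
  have hne0 : ∀ i, i ≠ 0 → G.symm (p i - p 0) ≠ 0 := fun i hi h => by
    have : G.symm (p i - p 0) = G.symm (p 0 - p 0) := by rw [h, sub_self, map_zero]
    exact hne i 0 hi this
  have key := mem_fcc_of_three_site_contacts hnorm (hv 1) (hv 2) (hv 3) (hne0 1 (by decide)) (hne0 2 (by decide))
    (hne0 3 (by decide)) (hne 1 2 (by decide)) (hne 1 3 (by decide)) (hne 2 3 (by decide)) (hdist 1) (hdist 2) (hdist 3)
  have h := fcc_add_site_mem key (hlat 0)
  rwa [hx', ← map_add, sub_add_sub_cancel] at h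

open scoped Classical in
/-- **AN OFF-LATTICE BALL TOUCHES AT MOST THREE LATTICE BALLS**: if `x ∉ y + G·Λ₀`, at most three balls of `X` on the coset
`y + G·Λ₀` are at distance `1` from `x`. -/
theorem card_lattice_contacts_le_three (G : EuclideanSpace ℝ (Fin 3) ≃ₗᵢ[ℝ] EuclideanSpace ℝ (Fin 3))
    (X : Finset (EuclideanSpace ℝ (Fin 3))) (y x : EuclideanSpace ℝ (Fin 3))
    (hx : G.symm (x - y) ∉ fccStacking 1 (Real.sqrt (2 / 3))) :
    (X.filter fun u => G.symm (u - y) ∈ fccStacking 1 (Real.sqrt (2 / 3)) ∧ dist x u = 1).card ≤ 3 := by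
  by_contra hlt
  push Not at hlt
  set S := X.filter fun u => G.symm (u - y) ∈ fccStacking 1 (Real.sqrt (2 / 3)) ∧ dist x u = 1 with hS
  obtain ⟨T, hTS, hT⟩ := Finset.exists_subset_card_eq (show 4 ≤ S.card by omega)
  -- an injection `Fin 4 → T`
  have e : T ≃ Fin 4 := Finset.equivFinOfCardEq hT
  let p : Fin 4 → EuclideanSpace ℝ (Fin 3) := fun i => (e.symm i).1
  have hpmem : ∀ i, p i ∈ S := fun i => hTS (e.symm i).2
  have hpinj : Function.Injective p := fun i j hij => by
    have : e.symm i = e.symm j := Subtype.ext hij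
    exact e.symm.injective this
  exact hx (mem_lattice_of_four_contacts G y x p hpinj (fun i => (Finset.mem_filter.1 (hpmem i)).2.1)
    (fun i => (Finset.mem_filter.1 (hpmem i)).2.2))

end Geometry

end LatticeContacts

end Summit.Ventures.Crystal3D.Theorems

end
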